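import Literature.Claims.NS.ClayVariants
import Literature.Analysis.FluidPDE.ClassicalSolution
import Literature.Analysis.FluidPDE.VectorCalculus
import Mathlib.Analysis.InnerProductSpace.Laplacian
import Mathlib.Analysis.Normed.Group.Bounded
import Mathlib.Topology.Algebra.Support
import Mathlib.MeasureTheory.Measure.Typeclasses.Finite
import HarnessLib

/-!
# Claim skeleton: Prástaro (2015), «The Maslov index in PDEs geometry», Appendix A / Example 4.5 —
# «a new proof of global smooth solutions existence, defined on all ℝ³, for the Navier-Stokes PDE»

Cell `ns-claims` (D-0090 NS-CLAIMS SWEEP), claim C29, typist `ns-claims-typist-9` (g2).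
UNREFEREED/DISPUTED CLAIM under adjudication — NOTHING in this file asserts a step: every `Step…`
declaration is a `Prop` (one printed assertion or asserted implication, typed concretely so that its
negation or its vacuity can be a kernel theorem in
`Summits/NavierStokesRegularity/NavierStokesRegularity/Theorems/SoloRefutePrastaro2015.lean`); the
`theorem`s are unfolding lemmas, the kernel COMPOSITIONS of the paper's own implications, and three
elementary TRUE facts about the typed objects (`theoremA1_literal_holds`, `footnote26_clayConditions`,
`clay_of_claimed_of_delta`) recorded so that the referee's charitable re-typings are kernel objects.

Version of record: A. Prástaro, arXiv:1503.07851 **v4** [math.GM], 16 Nov 2015, 40 pp. (last e-print;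
later a Springer chapter, doi:10.1007/978-3-319-31338-2_13, same text). Bib key `Prastaro2015Maslov`.
Print page = PDF page; TeX lines = `pub/ns-claims/sources/Prastaro2015/arxiv/1503.07851v4-2015-11-16.tex`;
page texts `…/1503.07851v4-pages/p0001–p0040.txt`; locators `sources/Prastaro2015/LOCATORS.md`
(ns-claims-lit-4). The geometric equation `(NS) ⊂ J²₄(W)` and its completely integrable part `(NS)^`
are imported by the paper from its refs. [39]/[49]; the explicit polynomial system is printed in [49] =
arXiv:0811.3693 v18, Tab. 1 p. 29 (TeX l.1694–1740; bib `Prastaro2008Crystal`), reduced below to global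
Cartesian coordinates on the Galilean space-time `M ≅ ℝ × ℝ³` (metric `g = δ`, connection `G = 0`, so
`R = S = W = W̄ = 0` there): (A) `div v = 0`; (C) `ρ((v·∇)v + ∂ₜv) + χ Δv + ∇p + ρ ∇f = 0`
(viscous term `ẋʲᵢₛ T^{is}`, `T^{is} = χ g^{is}`, sign AS PRINTED); (D) `ρ C_p (∂ₜθ + v·∇θ) − κ Δθ −
χ (|∇v|²_F + tr((∇v)²)) = 0` (`Ē^{is} = −κ g^{is}`, the print's thermal `ν` renamed `κ`;
`Y^{ip}_{ks} = −χ[g_{ks}g^{ip} + δᵖ_k δⁱ_s]`); (B) = first prolongation of (A), automatic for `C^∞`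
solutions on an open set and not typed separately. CLAY DICTIONARY for (C): dividing by `ρ`,
`∂ₜv + (v·∇)v = (−χ/ρ) Δv − ∇(p/ρ) − ∇f`, i.e. Fefferman's (1) with viscosity `ν_Clay = −χ/ρ`, pressure
`p/ρ`, force `−∇f`; every Step below is INSENSITIVE to the sign of `χ` (the perturbations at issue have
compact SPACE-TIME support, so parabolic energy arguments run in whichever time direction dissipates).

## Claimed statement (as printed)

Abstract p. 1: «As a by-product it is given a new proof of global smooth solutions existence, defined on
all ℝ³, for the Navier-Stokes PDE.» §1 p. 2: «Theorem A1 in Appendix A supports the method, given in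
Example 4.5, to build smooth global solutions of the Navier-Stokes PDEs, defined on all ℝ³.»
**Theorem A1** p. 32 (TeX l.1392–1394): «Any constant smooth solutions of the Navier-Stokes equation
(NS) ⊂ JD²(W) ⊂ J²₄(W), admits perturbations that identify smooth non-constant solutions of (NS) ⊂
JD²(W) ⊂ J²₄(W).» — with the proof's definition of the perturbation, p. 33 (A.6) (TeX l.1468–1474):
«s̄ = s + ν, where ν is a smooth perturbation of s on the disk D⁴, such that ν|_{S³} = 0 and
lim_{p→S³} ν(p) = 0, ν|_{∁D⁴} = 0». Typed: `ClaimedTheorem` (= `TheoremA1`): every constant global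
smooth solution `s` of every medium admits a global smooth solution `s̄` which agrees with `s` outside a
compact space-time set and is not constant. Footnote 26 p. 28 (the Clay reading) and the data sentence
«by varying the localized perturbation one can obtain different initial conditions, and as a by-product
global smooth solutions» are typed separately (`footnote26_clayConditions`, `ClayDelta`).

## Clay delta (reference `ClayVariants.lean`)

Nearest: (A) = `ClayVariants.clayR3.Regularity`. Δ1 domain ℝ³ (time two-sided) = · Δ2 non-isothermal
system (v, p, θ), constant density, potential force; the (v, p)-part is (1)–(2) with ν_Clay = −χ/ρ and a
gradient force ≈ · Δ3 ∇f = 0 at any constant solution ((66)) = · **Δ4 DATA CLASS ≠** (no Cauchy datum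
is prescribed anywhere in print) · Δ5 C^∞ sections, (7) asserted for the zero-flow family (TRUE:
`footnote26_clayConditions`) · **Δ6 FORM OF CONCLUSION ≠** («∃ a family of non-constant global smooth
solutions» vs «∀ u₀ ∈ (4) ∃»). `clay_of_claimed` is NOT provable; `ClayDelta` = the surjectivity of the
zero-flow family's `t = 0` velocity traces onto Clay's data class (4) (the only printed sentence about
data is footnote 26's «by varying the localized perturbation one can obtain different initial
conditions»); `clay_of_claimed_of_delta : ClayDelta → ClaimedTheorem → clayR3.Regularity` is PROVED
(`RegularityAt` assembled by hand: smoothness restricts to `t ≥ 0`, bounded energy from compact support).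

## Steps (paper item · print page · TeX lines · typist's private flag) — ordered index (HYGIENE 11)

* Step 1 = `Step1_ConstantSolutions` — Example 4.5 (66) p. 28 (l.1262–1277): a constant section
  `s = (v₀, p₀, θ₀)` solves `(NS)^` iff `ρ ∂ₖf = 0` («such constant solutions exist iff they are localized
  in a equipotential space-region») — plausible/true (support; supplies the base solution and, via Lemma
  A1's own fallback «Otherwise we could take a different constant value from s», the local solution s₀).
* Step 2 = `Step2_LemmaA1` — Lemma A1 p. 32 (l.1400–1415): near any point there is a local smooth
  (analytic) solution `s₀` not coinciding with the constant solution `s` — true (support).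
* Step 3 = `Step3_LemmaA2 R` — Lemma A2 pp. 32–33 with (A.4)–(A.5), footnote 28, Tab. 4 p. 34
  (l.1417–1466): «their boundary are both diffeomorphic to S³, therefore must exist a smooth solution
  V^∞ ⊂ (NS)^₊∞ ⊂ J^∞₄(W) such that ∂V^∞ = N₊∞ ∪ (N₀)₊∞ … In fact Ω^{(NS)^}_{3,s} ≅ Ω₃ = 0 … (A.5)
  X = Ṽ₊∞ ∪ V^∞ ∪ V̂˜₊∞ is a smooth solution of (NS)^₊∞, hence of (NS)» — an existence statement about
  the author's integral bordism (integral 4-manifolds of the Cartan distribution, possibly «climbing on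
  the fibers», p. 34), imported from Theorem 3.10 p. 19 and refs. [39], [41], [43]; TYPED ABSTRACTLY over
  an uninterpreted `Reading` (HYGIENE 7/13: bookkeeping carrier) — not kernel-testable; flag: abstract.
* Step 4 = `Step4_Regularisation R` — p. 33 l.60–66 (TeX l.1462–1476: «let us assume that V^∞ can be
  realized by means of a section s_∞ … X = D^∞s̄(M) for some smooth global section s̄ … s̄ = s + ν …
  (A.6)») together with the closing paragraph p. 34 (TeX l.1484–1490: «we can deform any eventual piece
  climbing on the fibers in such a way to obtain a regular solution … By conclusion Ỹ₊∞ is necessarily a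
  regular solution of (NS)^₊∞ ⊂ JD^∞(W). Therefore it can be obtained by a perturbation of the constant
  solution s»): the glued solution is (deformable to) a REGULAR one — a smooth global SECTION equal to
  `s` off the 4-disk `D⁴` and to `s₀` on `D⁴₀`. Concrete twin `Step4_concrete` = what Steps 3 ∧ 4
  deliver for every gluing datum (`step4_concrete_of`, `step4_concrete_iff`) — SUSPICIOUS, LOAD-BEARING
  (typist's PREDICTION: false — a smooth solution equal to a constant one outside a compact space-time
  set is that constant solution: energy identity for `w = v − v₀`, `d/dt ‖w‖₂² = (2χ/ρ)‖∇w‖₂²`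
  monotone and vanishing at both time ends; then `∇(p − p₀) = 0` with compact support, and the heat
  energy identity for `θ − θ₀`).
* Step 5 = `Step5_LemmaA3` — Example 4.5 p. 28 l.19–21 (TeX l.1279–1280: «Since solutions of
  (NS)‾^[s] locally transform solutions of (NS)^ into other solutions of this last equation») and Lemma
  A3 pp. 33–34 (l.1478–1480): a smooth solution `ν` of the LINEARISED system at the constant solution
  `s` makes `s + ν` a solution of `(NS)^` — suspicious (superposition for a quadratic system); consumed
  only by Example 4.5's own route (`claim_of_steps_example45`), not by Appendix A's.
* Step 6 = `Step6_LocalLinearised` — Example 4.5 p. 28 l.17–22 (TeX l.1277–1281: «in a space-time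
  neighbourhood of a point q ∈ (NS)‾^[s] we can build a smooth solution, say ν : M → s*vTW … the
  perturbation being only localized into a local space-time region») + Fig. 1 caption p. 29: a non-zero,
  compactly supported, global smooth solution of the linearised system exists — suspicious (same energy
  mechanism as Step 4); Example 4.5's route only.
* `ClaimedTheorem` = `TheoremA1` (Theorem A1 p. 32 in the (A.6) form p. 33). Charitable support-free
  reading `TheoremA1_literal` («admits … non-constant solutions», no support condition) is TRUE and
  content-free — PROVED (`theoremA1_literal_holds`: the pressure gauge `p₀ + sin t`).
* `ClayDelta` (Δ4/Δ6) — footnote 26 p. 28 (TeX l.1282) «Really by varying the localized perturbation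
  one can obtain different initial conditions, and as a by-product global smooth solutions» + abstract
  p. 1: the bridge from the zero-flow family to Clay (A) = every Clay datum is a `t = 0` trace. Not in
  print as a statement; `clay_of_claimed_of_delta` PROVED, `clay_of_claimed` not provable.

## COMPOSITION — proved as `claim_of_steps` (Appendix A = the proof of record, p. 32 «we shall
explicitly prove a theorem that one has implicitly used in Example 4.5»)

`claim_of_steps : Step1 → Step2 → Step3 R → Step4 R → ClaimedTheorem` for EVERY reading `R` — PROVED:
given a constant solution `s` of the medium `m`, Step 1 gives `∇f = 0` and hence that the constant
section `s₀ := (v₀, p₀ + 1, θ₀)` is again a solution (Lemma A1's own fallback); with `D⁴`, `D⁴₀` the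
closed balls of radii 2, 1 about the origin of `ℝ × ℝ³` this is a `GluingData`; Steps 3–4 return a
regular glued section `s̄`, which agrees with `s` off `D⁴` and differs from it at the centre. Step 2 is
carried as a hypothesis in print order (it is not needed beyond the fallback). Example 4.5's parallel
route: `claim_of_steps_example45 : Step1 → Step6 → Step5 → ClaimedTheorem` — PROVED. The paper's logic
COMPOSES along both routes; the adjudication is about the truth of Step 4 (concrete twin
`Step4_concrete`, pp. 33–34) on the route of record, with Step 6 (p. 28) its image on Example 4.5's
route and Step 5 (p. 28 / Lemma A3) a further printed assertion on that route.

## Design / conventions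

* Space-time `ℝ × E3`, `E3 = EuclideanSpace ℝ (Fin 3)`, time first, sup-product metric (a closed
  metric ball is a compact box — «a compact domain D ⊂ M identified with a 4-dimensional disk», p. 32).
  Sections of `π : W → M` in the chart are triples `WSection = (v, p, θ)`; media carry `ρ, C_p, κ > 0`,
  `χ ≠ 0` (viscous), a smooth time-independent potential `f` (Tab. 1 has `∂xᵢ.f`, `i = 1,2,3` only).
* Solutions on an OPEN space-time set `U` (`IsSolutionOn m U s`): components `C^∞` on `U`, equations
  (A), (C), (D) pointwise on `U` with two-sided time derivatives `deriv` (legitimate on open sets);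
  global = `U = univ`. Linearised system at a constant section (`IsLinearisedSolutionOn`): the formal
  derivative of (A), (C), (D) at `(v₀, p₀, θ₀)` (the quadratic heating term has zero derivative at
  `∇v₀ = 0`).
* No instance, no notation, no axiom, no sorry; `WSection` algebra is by explicit `def`s.

WHAT THIS IS NOT: not a claim about NS regularity or blow-up; not a claim about any author beyond the
typed locator.
-/

open MeasureTheory Set Function
open scoped ContDiff Laplacian InnerProductSpace RealInnerProductSpace

namespace Literature.Claims.NS.Prastaro2015

open Literature.Analysis.FluidPDE

noncomputable section

/-! ## §A. Vocabulary (definitions with bodies; nothing asserted) -/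

/-- Physical space `ℝ³` (Cartesian chart of the affine 3-space of Galilean simultaneity).
[cite: Prastaro2015Maslov, Example 4.5 p. 27] -/
abbrev E3 : Type := EuclideanSpace ℝ (Fin 3)

/-- A MEDIUM for the non-isothermal incompressible Navier–Stokes system `(NS)^` of Tab. 1 of ref. [49]
(arXiv:0811.3693 v18 p. 29), in global Cartesian coordinates: constant density `ρ > 0`, specific heat
`C_p > 0`, thermal coefficient `κ > 0` (printed `ν`, in `Ē^{is} = −ν g^{is}`), viscosity coefficient
`χ ≠ 0` (in `T^{is} = χ g^{is}`, sign as printed: Clay's viscosity is `−χ/ρ`), and a smooth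
time-independent body-force potential `f` (term `ρ (∂xᵢ.f) g^{ij}`). Hypothesis-structure, no instance
(TYPING-HYGIENE 7). [cite: Prastaro2008Crystal, Tab. 1 p. 29] -/
structure Medium where
  /-- density `ρ` -/
  ρ : ℝ
  /-- specific heat `C_p` -/
  Cp : ℝ
  /-- thermal coefficient (printed `ν`) -/
  κ : ℝ
  /-- viscosity coefficient `χ` of `T^{is} = χ g^{is}` -/
  χ : ℝ
  /-- body-force potential `f = f(x¹, x², x³)` -/
  f : E3 → ℝ
  ρ_pos : 0 < ρ
  Cp_pos : 0 < Cp
  κ_pos : 0 < κ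
  χ_ne : χ ≠ 0
  f_smooth : ContDiff ℝ ∞ f

/-- A section `s = (v, p, θ)` of the configuration bundle `π : W ≅ M × I × ℝ² → M` in the Cartesian
chart: velocity, pressure, temperature as functions of `(t, x)`, time first.
[cite: Prastaro2015Maslov, Example 4.5 p. 27] -/
structure WSection where
  /-- velocity field `v(t, x)` -/
  v : ℝ → E3 → E3
  /-- isotropic pressure `p(t, x)` -/
  p : ℝ → E3 → ℝ
  /-- temperature `θ(t, x)` -/
  θ : ℝ → E3 → ℝ

/-- The value `(v, p, θ)(q)` of a section at the space-time point `q = (t, x)`. [folklore] -/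
def WSection.eval (s : WSection) (q : ℝ × E3) : E3 × ℝ × ℝ :=
  (s.v q.1 q.2, s.p q.1 q.2, s.θ q.1 q.2)

/-- The constant section `(v₀, p₀, θ₀)`. [cite: Prastaro2015Maslov, Example 4.5 (66) p. 28] -/
def WSection.const (v₀ : E3) (p₀ θ₀ : ℝ) : WSection :=
  ⟨fun _ _ => v₀, fun _ _ => p₀, fun _ _ => θ₀⟩

/-- `s` is a constant section. [cite: Prastaro2015Maslov, Example 4.5 p. 28] -/
def WSection.IsConstant (s : WSection) : Prop :=
  ∃ (v₀ : E3) (p₀ θ₀ : ℝ), s = WSection.const v₀ p₀ θ₀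

/-- The perturbed section `s + ν` (the affine structure of `W`, p. 33: «s̄ = s + ν»).
[cite: Prastaro2015Maslov, (A.6) p. 33] -/
def WSection.perturb (s ν : WSection) : WSection :=
  ⟨fun t x => s.v t x + ν.v t x, fun t x => s.p t x + ν.p t x, fun t x => s.θ t x + ν.θ t x⟩

/-- Value of the constant section (unfolding). [cite: Prastaro2015Maslov, Example 4.5 (66) p. 28] -/
@[simp] theorem WSection.eval_const (v₀ : E3) (p₀ θ₀ : ℝ) (q : ℝ × E3) :
    (WSection.const v₀ p₀ θ₀).eval q = (v₀, p₀, θ₀) := rfl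

/-- Velocity of the constant section (unfolding). [cite: Prastaro2015Maslov, Example 4.5 (66) p. 28] -/
@[simp] theorem WSection.const_v (v₀ : E3) (p₀ θ₀ : ℝ) (t : ℝ) (x : E3) :
    (WSection.const v₀ p₀ θ₀).v t x = v₀ := rfl

/-- Pressure of the constant section (unfolding). [cite: Prastaro2015Maslov, Example 4.5 (66) p. 28] -/
@[simp] theorem WSection.const_p (v₀ : E3) (p₀ θ₀ : ℝ) (t : ℝ) (x : E3) :
    (WSection.const v₀ p₀ θ₀).p t x = p₀ := rfl

/-- Temperature of the constant section (unfolding). [cite: Prastaro2015Maslov, Example 4.5 (66) p. 28] -/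
@[simp] theorem WSection.const_θ (v₀ : E3) (p₀ θ₀ : ℝ) (t : ℝ) (x : E3) :
    (WSection.const v₀ p₀ θ₀).θ t x = θ₀ := rfl

/-! ### The printed equations (Tab. 1 of [49] in Cartesian coordinates) -/

/-- (A) continuity equation `ẋᵏ Gʲⱼₖ + ẋⁱₛ δˢᵢ = 0`, Cartesian: `div v(t, ·) = 0` at `x`.
[cite: Prastaro2008Crystal, Tab. 1 (A) p. 29] -/
def EqA (s : WSection) (t : ℝ) (x : E3) : Prop :=
  VectorCalculus.divergence (s.v t) x = 0

/-- (C) motion equation `ẋˢẋʲₛ ρ + ρ ẋʲ₀ + ẋʲᵢₛ T^{is} + pᵢ g^{ij} + ρ (∂xᵢ.f) g^{ij} = 0`,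
`T^{is} = χ g^{is}`, Cartesian: `ρ ((v·∇)v + ∂ₜv) + χ Δv + ∇p + ρ ∇f = 0` at `(t, x)` (two-sided time
derivative). [cite: Prastaro2008Crystal, Tab. 1 (C) p. 29] -/
def EqC (m : Medium) (s : WSection) (t : ℝ) (x : E3) : Prop :=
  m.ρ • (convect (s.v t) (s.v t) x + deriv (fun τ => s.v τ x) t) + m.χ • (Δ (s.v t)) x
    + gradient (s.p t) x + m.ρ • gradient m.f x = 0

/-- (D) energy equation `θ₀ ρ C_p + ρ C_p ẋᵏ θₖ + θᵢₛ Ē^{is} + ẋᵏ ẋᵖ W_{kp} + ẋᵏ ẋˢₚ W̄ᵖₖₛ +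
ẋᵏᵢ ẋˢₚ Y^{ip}_{ks} = 0` with `Ē^{is} = −κ g^{is}`, `W = W̄ = 0` (Cartesian), `Y^{ip}_{ks} =
−χ [g_{ks} g^{ip} + δᵖₖ δⁱₛ]`: `ρ C_p (∂ₜθ + Dθ(x)[v]) − κ Δθ − χ (|Dv|²_F + tr(Dv ∘ Dv)) = 0` at
`(t, x)`. [cite: Prastaro2008Crystal, Tab. 1 (D) p. 29] -/
def EqD (m : Medium) (s : WSection) (t : ℝ) (x : E3) : Prop :=
  m.ρ * m.Cp * (deriv (fun τ => s.θ τ x) t + fderiv ℝ (s.θ t) x (s.v t x))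
    - m.κ * (Δ (s.θ t)) x
    - m.χ * (frobeniusNormSq (fderiv ℝ (s.v t) x)
        + LinearMap.trace ℝ E3
            ((fderiv ℝ (s.v t) x : E3 →ₗ[ℝ] E3) ∘ₗ (fderiv ℝ (s.v t) x : E3 →ₗ[ℝ] E3))) = 0

/-- `s` is a smooth solution of `(NS)^` over the OPEN space-time set `U ⊆ M` («smooth (analytic)
solution in a neighborhood U₀», p. 32; global solutions: `U = univ`): the three components are `C^∞` on
`U` and (A), (C), (D) hold at every point of `U` ((B), the first prolongation of (A), then holds on `U`
automatically). [cite: Prastaro2015Maslov, Example 4.5 p. 27; Lemma A1 p. 32] -/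
structure IsSolutionOn (m : Medium) (U : Set (ℝ × E3)) (s : WSection) : Prop where
  isOpen : IsOpen U
  smooth_v : ContDiffOn ℝ ∞ (uncurry s.v) U
  smooth_p : ContDiffOn ℝ ∞ (uncurry s.p) U
  smooth_θ : ContDiffOn ℝ ∞ (uncurry s.θ) U
  eqA : ∀ q ∈ U, EqA s q.1 q.2
  eqC : ∀ q ∈ U, EqC m s q.1 q.2
  eqD : ∀ q ∈ U, EqD m s q.1 q.2

/-- Global smooth solution on all of space-time `M ≅ ℝ × ℝ³` («global smooth section», p. 27).
[cite: Prastaro2015Maslov, Example 4.5 p. 27–28] -/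
def IsGlobalSolution (m : Medium) (s : WSection) : Prop :=
  IsSolutionOn m univ s

/-- A global solution restricts to a solution on every open set («global smooth section» ⇒ local
solution, Example 4.5 p. 27 / Lemma A1 p. 32). [cite: Prastaro2015Maslov, Example 4.5 p. 27] -/
theorem IsSolutionOn.of_global {m : Medium} {s : WSection} (h : IsGlobalSolution m s)
    {U : Set (ℝ × E3)} (hU : IsOpen U) : IsSolutionOn m U s where
  isOpen := hU
  smooth_v := h.smooth_v.mono (subset_univ U)
  smooth_p := h.smooth_p.mono (subset_univ U)
  smooth_θ := h.smooth_θ.mono (subset_univ U)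
  eqA q _ := h.eqA q (mem_univ q)
  eqC q _ := h.eqC q (mem_univ q)
  eqD q _ := h.eqD q (mem_univ q)

/-! ### The linearised system at a constant section (Example 4.5 p. 28, Lemma A3 p. 33–34) -/

/-- Linearised (A) at a constant section: `div ν_v = 0`. [cite: Prastaro2015Maslov, Example 4.5 p. 28] -/
def LinEqA (ν : WSection) (t : ℝ) (x : E3) : Prop :=
  VectorCalculus.divergence (ν.v t) x = 0

/-- Linearised (C) at the constant section with velocity `v₀` (`∇v₀ = 0`, `f` not varied):
`ρ (Dν_v(x)[v₀] + ∂ₜ ν_v) + χ Δν_v + ∇ν_p = 0`. [cite: Prastaro2015Maslov, Example 4.5 p. 28] -/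
def LinEqC (m : Medium) (v₀ : E3) (ν : WSection) (t : ℝ) (x : E3) : Prop :=
  m.ρ • (fderiv ℝ (ν.v t) x v₀ + deriv (fun τ => ν.v τ x) t) + m.χ • (Δ (ν.v t)) x
    + gradient (ν.p t) x = 0

/-- Linearised (D) at the constant section with velocity `v₀` (the heating term, quadratic in `∇v`, has
zero derivative at `∇v₀ = 0`; `∇θ₀ = 0`): `ρ C_p (∂ₜ ν_θ + Dν_θ(x)[v₀]) − κ Δν_θ = 0`.
[cite: Prastaro2015Maslov, Example 4.5 p. 28] -/
def LinEqD (m : Medium) (v₀ : E3) (ν : WSection) (t : ℝ) (x : E3) : Prop :=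
  m.ρ * m.Cp * (deriv (fun τ => ν.θ τ x) t + fderiv ℝ (ν.θ t) x v₀) - m.κ * (Δ (ν.θ t)) x = 0

/-- `ν` is a smooth solution, over the open set `U`, of the linearised Navier–Stokes system
`(NS)‾^[s]` at the constant section `s` with velocity `v₀` («the linearized Navier-Stokes equation at
such solutions … a linear sub-PDE (NS)‾^[s] ⊂ (NS)‾[s] that is formally integrable and completely
integrable», p. 28). [cite: Prastaro2015Maslov, Example 4.5 p. 28] -/
structure IsLinearisedSolutionOn (m : Medium) (v₀ : E3) (U : Set (ℝ × E3)) (ν : WSection) :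
    Prop where
  isOpen : IsOpen U
  smooth_v : ContDiffOn ℝ ∞ (uncurry ν.v) U
  smooth_p : ContDiffOn ℝ ∞ (uncurry ν.p) U
  smooth_θ : ContDiffOn ℝ ∞ (uncurry ν.θ) U
  linA : ∀ q ∈ U, LinEqA ν q.1 q.2
  linC : ∀ q ∈ U, LinEqC m v₀ ν q.1 q.2
  linD : ∀ q ∈ U, LinEqD m v₀ ν q.1 q.2

/-! ### Gluing data of Lemma A1 and the regular glued section of pp. 33–34 -/

/-- The output of Lemma A1 p. 32 = the input of Lemma A2: a constant global solution `s`, a compact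
4-disk `D⁴ = closedBall c R` of space-time, a smaller disk `D⁴₀ = closedBall c r ⊂ U₀ ⊂ D⁴` about its
centre, and a local smooth solution `s₀` on the neighbourhood `U₀` which does not coincide with `s` on
`D⁴₀` («We can assume that s₀ does not coincide with s», p. 32; for the analytic `s₀` of the print,
`s₀ ≠ s` on the connected `U₀` gives `s₀ ≠ s` on `D⁴₀`). The pieces `Ṽ = s|_{M ∖ D⁴}` (boundary `N ≅ S³`)
and `V̂˜ = s₀|_{D⁴₀}` (boundary `N₀ ≅ S³`) are the two solutions of (A.1)–(A.3).
[cite: Prastaro2015Maslov, Lemma A1 (A.1)–(A.3) p. 32] -/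
structure GluingData (m : Medium) where
  /-- the constant solution `s` -/
  s : WSection
  /-- centre `p₀` of the disks -/
  c : ℝ × E3
  /-- radius of `D⁴` -/
  R : ℝ
  /-- radius of `D⁴₀` -/
  r : ℝ
  /-- the neighbourhood `U₀ ⊂ D⁴` of the centre carrying `s₀` -/
  U₀ : Set (ℝ × E3)
  /-- the local solution `s₀` -/
  s₀ : WSection
  s_const : s.IsConstant
  s_sol : IsGlobalSolution m s
  r_pos : 0 < r
  r_lt : r < R
  ball_sub : Metric.closedBall c r ⊆ U₀
  U₀_sub : U₀ ⊆ Metric.ball c R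
  s₀_sol : IsSolutionOn m U₀ s₀
  s₀_ne : ∃ q ∈ Metric.closedBall c r, s₀.eval q ≠ s.eval q

/-- The REGULAR glued solution of pp. 33–34 for the gluing datum `d`: a global smooth section `s̄`
(«X = D^∞s̄(M) for some smooth global section s̄ of π : W → M», p. 33 l.62–63) equal to `s` outside
`D⁴` («ν|_{∁D⁴} = 0», (A.6)) and to `s₀` on `D⁴₀` (the piece `V̂˜₊∞` of (A.5)).
[cite: Prastaro2015Maslov, (A.5)–(A.6) p. 33] -/
def GluingData.RegularGlued {m : Medium} (d : GluingData m) (sbar : WSection) : Prop :=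
  IsGlobalSolution m sbar ∧ (∀ q, q ∉ Metric.closedBall d.c d.R → sbar.eval q = d.s.eval q) ∧
    ∀ q ∈ Metric.closedBall d.c d.r, sbar.eval q = d.s₀.eval q

/-- Bookkeeping carrier for Lemma A2's objects (TYPING-HYGIENE 7, 13): the author's «smooth solution»
`X` of (A.5) is an integral 4-manifold of the Cartan distribution of `(NS)^₊∞`, possibly «climbing on the
fibers of π : W → M» (p. 34) — not a notion the kernel has; a READING supplies, for each gluing datum,
the uninterpreted proposition «such an X exists». [cite: Prastaro2015Maslov, Lemma A2 (A.5) p. 33] -/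
structure Reading (m : Medium) where
  /-- «X = Ṽ₊∞ ∪_{N₊∞} V^∞ ∪_{(N₀)₊∞} V̂˜₊∞ is a smooth solution of (NS)^₊∞, hence of (NS)» for `d` -/
  GluedSolutionExists : GluingData m → Prop

/-- The trivial reading (`X` always exists) — under it Step 4 is literally `Step4_concrete`. [folklore] -/
def Reading.trivial (m : Medium) : Reading m :=
  ⟨fun _ => True⟩

/-! ## §B. The claimed statement -/

/-- **Theorem A1** p. 32 (TeX l.1392–1394) in the form its proof gives it, (A.6) p. 33: every constant
smooth global solution `s` of `(NS)^` (any medium) admits a smooth global solution `s̄ = s + ν` with `ν`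
vanishing outside a compact space-time set («ν|_{∁D⁴} = 0», `D⁴` a compact 4-disk) and `s̄` not constant
(«smooth non-constant solutions»). [cite: Prastaro2015Maslov, Theorem A1 p. 32; (A.6) p. 33] -/
def TheoremA1 : Prop :=
  ∀ (m : Medium) (s : WSection), s.IsConstant → IsGlobalSolution m s →
    ∃ sbar : WSection, IsGlobalSolution m sbar ∧
      (∃ K : Set (ℝ × E3), IsCompact K ∧ ∀ q, q ∉ K → sbar.eval q = s.eval q) ∧ ¬ sbar.IsConstant

/-- The CLAIMED THEOREM of C29 = Theorem A1 in its (A.6) form (abstract p. 1: «a new proof of global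
smooth solutions existence, defined on all ℝ³, for the Navier-Stokes PDE»; §1 p. 2: «Theorem A1 in
Appendix A supports the method, given in Example 4.5»). [cite: Prastaro2015Maslov, Theorem A1 p. 32] -/
def ClaimedTheorem : Prop :=
  TheoremA1

/-- `ClaimedTheorem` is Theorem A1 (definitional). [cite: Prastaro2015Maslov, Theorem A1 p. 32] -/
theorem claimedTheorem_iff : ClaimedTheorem ↔ TheoremA1 := Iff.rfl

/-- Charitable SUPPORT-FREE reading of Theorem A1's sentence alone («admits perturbations that identify
smooth non-constant solutions», no (A.6)): a non-constant global smooth solution exists whenever a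
constant one does. TRUE and content-free (`theoremA1_literal_holds`: pressure gauge).
[cite: Prastaro2015Maslov, Theorem A1 p. 32] -/
def TheoremA1_literal : Prop :=
  ∀ (m : Medium) (s : WSection), s.IsConstant → IsGlobalSolution m s →
    ∃ sbar : WSection, IsGlobalSolution m sbar ∧ ¬ sbar.IsConstant

/-! ## §C. The steps -/

/-- **Step 1** — Example 4.5 (66) p. 28 (TeX l.1262–1277): «a constant section s : M → W, is surely a
solution for (NS), localized on a equipotential space region. In fact such solution satisfies (NS)^ iff
equations (66) are satisfied … by using global cartesian coordinates … equations (66) reduce to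
ρ (∂xₖ.f) = 0.» Typed: a constant section is a global solution iff `∇f ≡ 0`.
[cite: Prastaro2015Maslov, Example 4.5 (66) p. 28] -/
def Step1_ConstantSolutions : Prop :=
  ∀ (m : Medium) (v₀ : E3) (p₀ θ₀ : ℝ),
    IsGlobalSolution m (WSection.const v₀ p₀ θ₀) ↔ ∀ x, gradient m.f x = 0

/-- **Step 2** — Lemma A1 p. 32 (TeX l.1400–1415), its constructive core: «Let p₀ ∈ D⁴ be the center of
the disk. Since (NS)^ ⊂ JD²(W) is completely integrable, we can build a smooth (analytic) solution s₀ in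
a neighborhood U₀ ⊂ D⁴ of p₀ … We can assume that s₀ does not coincide with s. (Otherwise we could take
a different constant value from s.)» Typed: for every constant global solution `s`, every space-time
point `q₀` and radius `δ > 0` there are an open `U₀ ∋ q₀` inside `ball q₀ δ` and a smooth solution `s₀`
on `U₀` not coinciding with `s` on `U₀`. [cite: Prastaro2015Maslov, Lemma A1 p. 32] -/
def Step2_LemmaA1 : Prop :=
  ∀ (m : Medium) (s : WSection), s.IsConstant → IsGlobalSolution m s →
    ∀ (q₀ : ℝ × E3) (δ : ℝ), 0 < δ →
      ∃ (U₀ : Set (ℝ × E3)) (s₀ : WSection), IsOpen U₀ ∧ q₀ ∈ U₀ ∧ U₀ ⊆ Metric.ball q₀ δ ∧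
        IsSolutionOn m U₀ s₀ ∧ ∃ q ∈ U₀, s₀.eval q ≠ s.eval q

/-- **Step 3** — Lemma A2 pp. 32–33 (TeX l.1417–1466) with (A.4)–(A.5), footnote 28 and Tab. 4 p. 34:
«Since both solutions Ṽ and V̂˜ are smooth solutions we can consider their ∞-prolongations … their
boundary are both diffeomorphic to S³, therefore must exist a smooth solution V^∞ ⊂ (NS)^₊∞ ⊂ J^∞₄(W)
such that ∂V^∞ = N₊∞ ∪ (N₀)₊∞. In fact, from the commutative diagram 39 and Theorem 3.10 we get the
exact commutative diagram (A.4) … In fact Ω^{(NS)^}_{3,s} ≅ Ω₃ = 0. … (A.5) X = Ṽ₊∞ ∪ V^∞ ∪ V̂˜₊∞ is a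
smooth solution of (NS)^₊∞, hence of (NS).» ABSTRACT (the author's integral-bordism existence, for
integral manifolds possibly climbing on the fibres): under the reading `R`, the glued «smooth solution»
exists for every gluing datum. Not kernel-testable by design (HYGIENE 7/13).
[cite: Prastaro2015Maslov, Lemma A2 (A.4)–(A.5) p. 32–33] -/
def Step3_LemmaA2 (R : (m : Medium) → Reading m) : Prop :=
  ∀ (m : Medium) (d : GluingData m), (R m).GluedSolutionExists d

/-- **Step 4** — p. 33 l.60–66 (TeX l.1462–1476: «To conclude the proof let us assume that V^∞ can be
realized by means of a section s_∞ of π : W → M … Thus we can say that the solution X = D^∞s̄(M) for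
some smooth global section s̄ … s̄ = s + ν, where ν is a smooth perturbation of s on the disk D⁴, such
that ν|_{S³} = 0 and (A.6) … ν|_{∁D⁴} = 0») discharged by the closing paragraph p. 34 (TeX l.1484–1490:
«since Ṽ₊∞ and V̂˜₊∞ are both regular solutions … and (NS) ⊂ JD²(W) is an affine fiber bundle over its
projection at the first order, with non-zero symbol, it follows that we can deform any eventual piece
climbing on the fibers in such a way to obtain a regular solution … By conclusion Ỹ₊∞ is necessarily a
regular solution of (NS)^₊∞ ⊂ JD^∞(W). Therefore it can be obtained by a perturbation of the constant
solution s»; Fig. 2 p. 35: dim(g₂)_q = 46, dim(ĝ₂)_q = 42): under the reading `R`, whenever the glued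
solution of Lemma A2 exists it is (deformable to) a REGULAR glued section. LOAD-BEARING.
[cite: Prastaro2015Maslov, (A.6) p. 33; closing paragraph p. 34] -/
def Step4_Regularisation (R : (m : Medium) → Reading m) : Prop :=
  ∀ (m : Medium) (d : GluingData m), (R m).GluedSolutionExists d → ∃ sbar, d.RegularGlued sbar

/-- **Step 4, concrete twin** (F15 grain; = what Steps 3 ∧ 4 deliver, `step4_concrete_of`; = Step 4 under
the trivial reading, `step4_concrete_iff`): for EVERY gluing datum — constant solution `s`, disks
`D⁴₀ ⊂ D⁴`, local solution `s₀ ≠ s` on `D⁴₀` — there is a global smooth solution equal to `s` off `D⁴`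
and to `s₀` on `D⁴₀` (pp. 33–34 as above). This is the kernel-testable content of Appendix A.
[cite: Prastaro2015Maslov, (A.5)–(A.6) p. 33; closing paragraph p. 34] -/
def Step4_concrete : Prop :=
  ∀ (m : Medium) (d : GluingData m), ∃ sbar, d.RegularGlued sbar

/-- **Step 5** — Example 4.5 p. 28 l.19–21 (TeX l.1279–1280): «Since solutions of (NS)‾^[s] locally
transform solutions of (NS)^ into other solutions of this last equation, we get that the original
constant solution s can be transformed by means of the perturbation ν into another global solution
s′ : M → W»; Lemma A3 pp. 33–34 (l.1478–1480): «When perturbations of (NS)^ are realized by means of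
smooth solutions of the corresponding linearized Navier-Stokes PDE (NS)‾^[s] … then the identified
solutions of (NS) … are identified with smooth sections of π : W → M.» Typed (the transform sentence):
for a constant global solution `s = (v₀, p₀, θ₀)` and a smooth solution `ν` of the linearised system at
`s` over an open `U`, the section `s + ν` solves `(NS)^` over `U`.
[cite: Prastaro2015Maslov, Example 4.5 p. 28; Lemma A3 p. 33–34] -/
def Step5_LemmaA3 : Prop :=
  ∀ (m : Medium) (v₀ : E3) (p₀ θ₀ : ℝ), IsGlobalSolution m (WSection.const v₀ p₀ θ₀) →
    ∀ (U : Set (ℝ × E3)) (ν : WSection), IsLinearisedSolutionOn m v₀ U ν →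
      IsSolutionOn m U ((WSection.const v₀ p₀ θ₀).perturb ν)

/-- **Step 6** — Example 4.5 p. 28 l.14–22 (TeX l.1277–1281): «Let us denote by (NS)‾[s] ⊂ JD²(s*vTW)
such a linearized PDE at the constant solution s. … we can associate to (NS)‾[s] a linear sub-PDE
(NS)‾^[s] ⊂ (NS)‾[s] that is formally integrable and completely integrable. Then in a space-time
neighbourhood of a point q ∈ (NS)‾^[s] we can build a smooth solution, say ν : M → s*vTW. … the
perturbation being only localized into a local space-time region»; Fig. 1 caption p. 29: «The
perturbation, localized in the compact space-time region D ⊂ V …, is a smooth solution of the linearized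
equation (NS)‾^[s]». Typed: at every constant global solution there is a GLOBAL smooth solution `ν` of
the linearised system which vanishes outside a compact space-time set and is not identically zero.
[cite: Prastaro2015Maslov, Example 4.5 p. 28; Fig. 1 p. 29] -/
def Step6_LocalLinearised : Prop :=
  ∀ (m : Medium) (v₀ : E3) (p₀ θ₀ : ℝ), IsGlobalSolution m (WSection.const v₀ p₀ θ₀) →
    ∃ ν : WSection, IsLinearisedSolutionOn m v₀ univ ν ∧
      (∃ K : Set (ℝ × E3), IsCompact K ∧ ∀ q, q ∉ K → ν.eval q = 0) ∧ ∃ q, ν.eval q ≠ 0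

/-! ## §D. The Clay link (Δ4/Δ6) -/

/-- **ClayDelta** (Δ4 DATA CLASS / Δ6 FORM OF THE CONCLUSION; the hypothesis `hdata` of
`ClaySpec.RegularityAt` that no printed sentence supplies): footnote 26 p. 28 (TeX l.1282) «whether we
work with the constant solution with zero flow, we get a non-constant global solutions V′ … Therefore
this is another way to prove existence of global smooth solutions when one aims to obtain solutions
defined on all the space ℝ³. Really by varying the localized perturbation one can obtain different
initial conditions, and as a by-product global smooth solutions» READ AS the bridge to Clay (A): for
every Clay viscosity `ν > 0` and every Clay datum `u₀` (smooth, divergence-free, (4)) some member of the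
zero-flow family of a medium whose (v, p)-equations are Clay's (`ρ = 1`, `χ = −ν`, `∇f = 0`) — a global
smooth solution agreeing with the zero-flow constant section outside a compact space-time set — has
velocity `u₀` at `t = 0`. NOT a printed statement; the surjectivity it asserts is what «wrong problem
(Δ4/Δ6)» names. [cite: Prastaro2015Maslov, footnote 26 p. 28; abstract p. 1] -/
def ClayDelta : Prop :=
  ∀ ν : ℝ, 0 < ν → ∀ u₀ : E3 → E3, ContDiff ℝ ∞ u₀ → NSWave0.IsDivFree u₀ → HasRapidSpatialDecay u₀ →
    ∃ (m : Medium) (p₀ θ₀ : ℝ) (sbar : WSection), m.ρ = 1 ∧ m.χ = -ν ∧ (∀ x, gradient m.f x = 0) ∧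
      IsGlobalSolution m sbar ∧
      (∃ K : Set (ℝ × E3), IsCompact K ∧ ∀ q, q ∉ K → sbar.eval q = (WSection.const 0 p₀ θ₀).eval q) ∧
      sbar.v 0 = u₀

/-! ## §E. Compositions (kernel) -/

/-- Steps 3 ∧ 4 deliver the concrete Step 4 (for any reading). [cite: Prastaro2015Maslov, Appendix A p. 32–34] -/
theorem step4_concrete_of (R : (m : Medium) → Reading m) (h3 : Step3_LemmaA2 R)
    (h4 : Step4_Regularisation R) : Step4_concrete :=
  fun m d => h4 m d (h3 m d)

/-- The concrete Step 4 gives Step 4 under every reading. [cite: Prastaro2015Maslov, Appendix A p. 33–34] -/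
theorem step4_of_concrete (R : (m : Medium) → Reading m) (h : Step4_concrete) :
    Step4_Regularisation R :=
  fun m d _ => h m d

/-- Step 3 holds under the trivial reading. [cite: Prastaro2015Maslov, Lemma A2 p. 32–33] -/
theorem step3_trivial : Step3_LemmaA2 Reading.trivial :=
  fun _ _ => trivial

/-- Under the trivial reading Step 4 IS the concrete Step 4. [cite: Prastaro2015Maslov, Appendix A p. 33–34] -/
theorem step4_concrete_iff : Step4_concrete ↔ Step4_Regularisation Reading.trivial :=
  ⟨fun h => step4_of_concrete _ h, fun h => step4_concrete_of _ step3_trivial h⟩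

/-- A point of space-time outside the closed ball of radius `R` about `c` (move `R + 1` in time). [folklore] -/
private theorem exists_not_mem_closedBall (c : ℝ × E3) (R : ℝ) (hR : 0 < R) :
    (c.1 + (R + 1), c.2) ∉ Metric.closedBall c R := by
  intro h
  rw [Metric.mem_closedBall, Prod.dist_eq] at h
  have h1 : dist (c.1 + (R + 1)) c.1 ≤ R := le_trans (le_max_left _ _) h
  rw [Real.dist_eq] at h1
  have : |c.1 + (R + 1) - c.1| = R + 1 := by
    rw [show c.1 + (R + 1) - c.1 = R + 1 by ring]; exact abs_of_pos (by linarith)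
  linarith

/-- From a regular glued section for a gluing datum, Theorem A1's conclusion for its constant solution:
`s̄` agrees with `s` off the compact `D⁴` and is not constant (it differs from `s` on `D⁴₀` and agrees
with it far away). [cite: Prastaro2015Maslov, (A.5)–(A.6) p. 33] -/
theorem theoremA1_conclusion_of_regularGlued {m : Medium} (d : GluingData m) {sbar : WSection}
    (h : d.RegularGlued sbar) :
    IsGlobalSolution m sbar ∧
      (∃ K : Set (ℝ × E3), IsCompact K ∧ ∀ q, q ∉ K → sbar.eval q = d.s.eval q) ∧ ¬ sbar.IsConstant := by
  obtain ⟨hsol, hout, hin⟩ := h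
  refine ⟨hsol, ⟨Metric.closedBall d.c d.R, isCompact_closedBall _ _, hout⟩, ?_⟩
  rintro ⟨w₀, q₀, τ₀, hconst⟩
  obtain ⟨q, hq, hne⟩ := d.s₀_ne
  obtain ⟨v₀, p₀, θ₀, hs⟩ := d.s_const
  have hR : 0 < d.R := lt_trans d.r_pos d.r_lt
  -- far point: sbar = s there, so the constant value of sbar is that of s
  have hfar := hout _ (exists_not_mem_closedBall d.c d.R hR)
  rw [hconst, hs, WSection.eval_const, WSection.eval_const] at hfar
  -- near point: sbar = s₀ ≠ s there
  have hnear := hin q hq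
  rw [hconst, WSection.eval_const] at hnear
  apply hne
  rw [← hnear, hs, WSection.eval_const, hfar]

/-- **COMPOSITION, route of record (Appendix A)** — `Step 1 → Step 2 → Step 3 → Step 4 → Theorem A1`,
for every reading `R` of Lemma A2's objects. Step 1 supplies `∇f = 0` at a constant solution and hence
the local solution `s₀ :=` «a different constant value from s» (Lemma A1's own fallback, p. 32); the
disks are the closed balls of radii `2 ⊃ 1` about the origin; Steps 3–4 glue; the glued regular section
is the perturbed non-constant solution. Step 2 is carried in print order (underscored: the fallback
makes it unnecessary for the composition). [cite: Prastaro2015Maslov, Theorem A1 proof p. 32–34] -/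
theorem claim_of_steps (R : (m : Medium) → Reading m) (h1 : Step1_ConstantSolutions)
    (_h2 : Step2_LemmaA1) (h3 : Step3_LemmaA2 R) (h4 : Step4_Regularisation R) : ClaimedTheorem := by
  intro m s hs hsol
  obtain ⟨v₀, p₀, θ₀, rfl⟩ := hs
  -- Step 1, ⇒: the potential is equipotential
  have hf : ∀ x, gradient m.f x = 0 := (h1 m v₀ p₀ θ₀).1 hsol
  -- Step 1, ⇐: the different constant section is again a global solution
  have hsol₀ : IsGlobalSolution m (WSection.const v₀ (p₀ + 1) θ₀) := (h1 m v₀ (p₀ + 1) θ₀).2 hf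
  -- the gluing datum: D⁴ = closedBall 0 2, D⁴₀ = closedBall 0 1 ⊂ U₀ = ball 0 (3/2)
  let c : ℝ × E3 := (0, 0)
  have hU₀ : IsOpen (Metric.ball c (3 / 2)) := Metric.isOpen_ball
  let d : GluingData m :=
    { s := WSection.const v₀ p₀ θ₀
      c := c
      R := 2
      r := 1
      U₀ := Metric.ball c (3 / 2)
      s₀ := WSection.const v₀ (p₀ + 1) θ₀
      s_const := ⟨v₀, p₀, θ₀, rfl⟩
      s_sol := hsol
      r_pos := one_pos
      r_lt := by norm_num
      ball_sub := Metric.closedBall_subset_ball (by norm_num)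
      U₀_sub := Metric.ball_subset_ball (by norm_num)
      s₀_sol := IsSolutionOn.of_global hsol₀ hU₀
      s₀_ne := ⟨c, Metric.mem_closedBall_self (by norm_num), by
        simp [WSection.eval_const]⟩ }
  obtain ⟨sbar, hbar⟩ := h4 m d (h3 m d)
  exact ⟨sbar, theoremA1_conclusion_of_regularGlued d hbar⟩

/-- The concrete Step 4 alone (with Step 1) already yields the claim (reading-free form of the route of
record). [cite: Prastaro2015Maslov, Appendix A p. 32–34] -/
theorem claim_of_step4_concrete (h1 : Step1_ConstantSolutions) (h2 : Step2_LemmaA1)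
    (h4 : Step4_concrete) : ClaimedTheorem :=
  claim_of_steps Reading.trivial h1 h2 step3_trivial (step4_of_concrete _ h4)

/-- **COMPOSITION, Example 4.5's own route (p. 28)** — `Step 1 → Step 6 → Step 5 → Theorem A1`: the
compactly supported non-zero linearised solution `ν` of Step 6, transported by Step 5, gives the global
solution `s + ν`, which agrees with `s` off the compact set and is not constant.
[cite: Prastaro2015Maslov, Example 4.5 p. 28] -/
theorem claim_of_steps_example45 (_h1 : Step1_ConstantSolutions) (h6 : Step6_LocalLinearised)
    (h5 : Step5_LemmaA3) : ClaimedTheorem := by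
  intro m s hs hsol
  obtain ⟨v₀, p₀, θ₀, rfl⟩ := hs
  obtain ⟨ν, hν, ⟨K, hK, hout⟩, ⟨q, hq⟩⟩ := h6 m v₀ p₀ θ₀ hsol
  have hglob : IsSolutionOn m univ ((WSection.const v₀ p₀ θ₀).perturb ν) := h5 m v₀ p₀ θ₀ hsol univ ν hν
  refine ⟨(WSection.const v₀ p₀ θ₀).perturb ν, hglob, ⟨K, hK, fun q' hq' => ?_⟩, ?_⟩
  · have h0 := hout q' hq'
    have h0v : ν.v q'.1 q'.2 = 0 := by simpa [WSection.eval] using congrArg Prod.fst h0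
    have h0p : ν.p q'.1 q'.2 = 0 := by simpa [WSection.eval] using congrArg (fun z => z.2.1) h0
    have h0θ : ν.θ q'.1 q'.2 = 0 := by simpa [WSection.eval] using congrArg (fun z => z.2.2) h0
    simp only [WSection.eval, WSection.perturb, WSection.const, h0v, h0p, h0θ, add_zero]
  · rintro ⟨w₀, q₀, τ₀, hconst⟩
    -- ν = sbar − s is then constant, and zero far away, hence zero at q: contradiction
    apply hq
    -- a point outside K: K is bounded, hence inside some closed ball about q
    obtain ⟨Rr, hRr⟩ := hK.isBounded.subset_closedBall q
    have hfar_out : (q.1 + ((max Rr 1) + 1), q.2) ∉ K := by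
      intro hmem
      have := hRr hmem
      have hsub : Metric.closedBall q Rr ⊆ Metric.closedBall q (max Rr 1) :=
        Metric.closedBall_subset_closedBall (le_max_left _ _)
      exact exists_not_mem_closedBall q (max Rr 1) (lt_of_lt_of_le one_pos (le_max_right _ _))
        (hsub this)
    have hfar := hout _ hfar_out
    -- values of the perturbed section at q and at the far point coincide (it is constant)
    have hvq : ((WSection.const v₀ p₀ θ₀).perturb ν).eval q = (w₀, q₀, τ₀) := by
      rw [hconst, WSection.eval_const]
    have hvfar : ((WSection.const v₀ p₀ θ₀).perturb ν).eval (q.1 + ((max Rr 1) + 1), q.2) =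
        (w₀, q₀, τ₀) := by
      rw [hconst, WSection.eval_const]
    set q' : ℝ × E3 := (q.1 + ((max Rr 1) + 1), q.2) with hq'def
    have hf1 : ν.v q'.1 q'.2 = 0 := by simpa [WSection.eval] using congrArg Prod.fst hfar
    have hf2 : ν.p q'.1 q'.2 = 0 := by simpa [WSection.eval] using congrArg (fun z => z.2.1) hfar
    have hf3 : ν.θ q'.1 q'.2 = 0 := by simpa [WSection.eval] using congrArg (fun z => z.2.2) hfar
    have a1 : v₀ + ν.v q.1 q.2 = w₀ := by
      simpa [WSection.eval, WSection.perturb, WSection.const] using congrArg Prod.fst hvq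
    have a2 : p₀ + ν.p q.1 q.2 = q₀ := by
      simpa [WSection.eval, WSection.perturb, WSection.const] using congrArg (fun z => z.2.1) hvq
    have a3 : θ₀ + ν.θ q.1 q.2 = τ₀ := by
      simpa [WSection.eval, WSection.perturb, WSection.const] using congrArg (fun z => z.2.2) hvq
    have b1 : v₀ + ν.v q'.1 q'.2 = w₀ := by
      simpa [WSection.eval, WSection.perturb, WSection.const] using congrArg Prod.fst hvfar
    have b2 : p₀ + ν.p q'.1 q'.2 = q₀ := by
      simpa [WSection.eval, WSection.perturb, WSection.const] using congrArg (fun z => z.2.1) hvfar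
    have b3 : θ₀ + ν.θ q'.1 q'.2 = τ₀ := by
      simpa [WSection.eval, WSection.perturb, WSection.const] using congrArg (fun z => z.2.2) hvfar
    rw [hf1, add_zero] at b1
    rw [hf2, add_zero] at b2
    rw [hf3, add_zero] at b3
    have c1 : ν.v q.1 q.2 = 0 := by
      have := a1.trans b1.symm
      simpa using this
    have c2 : ν.p q.1 q.2 = 0 := by linarith
    have c3 : ν.θ q.1 q.2 = 0 := by linarith
    simp only [WSection.eval, c1, c2, c3]
    rfl

/-! ## §F. Elementary true facts about the typed objects (kernel; for the referee's charitable readings) -/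

/-- The support-free reading of Theorem A1's sentence is TRUE by the pressure gauge: if
`s = (v₀, p₀, θ₀)` is a global solution then so is `(v₀, p₀ + sin t, θ₀)`, which is not constant
(the pressure enters (C) only through its spatial gradient; (A), (D) do not see it). Hence Theorem A1
has content only through (A.6) (compact space-time support), typed in `TheoremA1`/`Step4_concrete`.
[cite: Prastaro2015Maslov, Theorem A1 p. 32] -/
theorem theoremA1_literal_holds : TheoremA1_literal := by
  intro m s hs hsol
  obtain ⟨v₀, p₀, θ₀, rfl⟩ := hs
  let sbar : WSection := ⟨fun _ _ => v₀, fun t _ => p₀ + Real.sin t, fun _ _ => θ₀⟩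
  have hC0 := hsol.eqC
  refine ⟨sbar, ?_, ?_⟩
  · refine ⟨isOpen_univ, ?_, ?_, ?_, ?_, ?_, ?_⟩
    · exact contDiffOn_const
    · have : uncurry sbar.p = fun q : ℝ × E3 => p₀ + Real.sin q.1 := by
        funext q; rfl
      rw [this]
      exact (contDiff_const.add (Real.contDiff_sin.comp contDiff_fst)).contDiffOn
    · exact contDiffOn_const
    · intro q _
      exact hsol.eqA q (mem_univ q)
    · intro q _
      have h := hC0 q (mem_univ q)
      -- the only pressure-dependent term is the spatial gradient, zero for both sections
      simp only [EqC, WSection.const] at h ⊢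
      have hg0 : gradient (fun _ : E3 => p₀) q.2 = 0 := gradient_fun_const q.2 p₀
      have hg1 : gradient (fun _ : E3 => p₀ + Real.sin q.1) q.2 = 0 :=
        gradient_fun_const q.2 (p₀ + Real.sin q.1)
      rw [hg0] at h
      rw [hg1]
      exact h
    · intro q _
      have h := hsol.eqD q (mem_univ q)
      simp only [EqD, WSection.const] at h ⊢
      exact h
  · rintro ⟨w₀, q₀, τ₀, hconst⟩
    have h0 : sbar.p 0 0 = q₀ := by rw [hconst]; rfl
    have h1 : sbar.p (Real.pi / 2) 0 = q₀ := by rw [hconst]; rfl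
    have e0 : sbar.p 0 0 = p₀ + Real.sin 0 := rfl
    have e1 : sbar.p (Real.pi / 2) 0 = p₀ + Real.sin (Real.pi / 2) := rfl
    rw [Real.sin_zero] at e0
    rw [Real.sin_pi_div_two] at e1
    linarith

/-- Bounded energy from compact space-time support (the content of footnote 26 item 2, p. 28): if
`u : ℝ → E3 → E3` is jointly continuous and vanishes outside a compact space-time set then
`t ↦ ∫ ‖u(t, x)‖² dx` is bounded (Fefferman's (7)). [cite: Prastaro2015Maslov, footnote 26 item 2 p. 28] -/
theorem hasBoundedEnergy_of_compact {u : ℝ → E3 → E3} (hu : Continuous (uncurry u))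
    {K : Set (ℝ × E3)} (hK : IsCompact K) (h0 : ∀ q, q ∉ K → uncurry u q = 0) :
    HasBoundedEnergy u := by
  -- uniform bound on the values
  have hsupp : HasCompactSupport (uncurry u) := HasCompactSupport.intro hK h0
  obtain ⟨C, hC⟩ := hu.bounded_above_of_compact_support hsupp
  -- spatial footprint inside a closed ball
  obtain ⟨Rr, hRr⟩ := (hK.image continuous_snd).isBounded.subset_closedBall (0 : E3)
  set B : Set E3 := Metric.closedBall (0 : E3) Rr with hB
  have hBmeas : MeasurableSet B := Metric.isClosed_closedBall.measurableSet
  have hBvol : volume B < ⊤ := measure_closedBall_lt_top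
  refine ⟨ENNReal.ofReal C ^ 2 * volume B, ENNReal.mul_lt_top (ENNReal.pow_lt_top ENNReal.ofReal_lt_top)
    hBvol, fun t _ => ?_⟩
  have hpt : ∀ x, ‖u t x‖ₑ ^ 2 ≤ B.indicator (fun _ => ENNReal.ofReal C ^ 2) x := by
    intro x
    by_cases hx : x ∈ B
    · rw [indicator_of_mem hx]
      have h1 : ‖u t x‖ₑ ≤ ENNReal.ofReal C := by
        rw [← ofReal_norm]
        exact ENNReal.ofReal_le_ofReal (hC (t, x))
      exact pow_le_pow_left' h1 2
    · have hnot : (t, x) ∉ K := by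
        intro hmem
        exact hx (hRr ⟨(t, x), hmem, rfl⟩)
      have : u t x = 0 := h0 (t, x) hnot
      rw [this, indicator_of_notMem hx]
      simp
  calc ∫⁻ x, ‖u t x‖ₑ ^ 2 ≤ ∫⁻ x, B.indicator (fun _ => ENNReal.ofReal C ^ 2) x := lintegral_mono hpt
    _ = ENNReal.ofReal C ^ 2 * volume B := lintegral_indicator_const hBmeas _

/-- **Footnote 26, items 1–2, are TRUE for every member of the zero-flow family** (p. 28: «we get a
non-constant global solutions V′ necessarily satisfying the following Clay-Navier-Stokes conditions:
1. v(x,t) ∈ [C^∞(ℝ³ × [0,∞))]³, p(x,t) ∈ C^∞(ℝ³ × [0,∞)) 2. There exists a constant E ∈ (0,∞) such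
that ∫_{ℝ³}|v(x,t)|² dx < E»): a global smooth solution agreeing with the zero-flow constant section
outside a compact space-time set has velocity and pressure smooth on `ℝ³ × [0,∞)` and bounded energy.
(So the family's defect toward Clay (A) is the DATA quantifier alone: `ClayDelta`.)
[cite: Prastaro2015Maslov, footnote 26 p. 28] -/
theorem footnote26_clayConditions {m : Medium} {p₀ θ₀ : ℝ} {sbar : WSection}
    (hsol : IsGlobalSolution m sbar) {K : Set (ℝ × E3)} (hK : IsCompact K)
    (hout : ∀ q, q ∉ K → sbar.eval q = (WSection.const 0 p₀ θ₀).eval q) :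
    IsSmoothOnHalfSpace sbar.v ∧ IsSmoothOnHalfSpace sbar.p ∧ HasBoundedEnergy sbar.v := by
  refine ⟨hsol.smooth_v.mono (subset_univ _), hsol.smooth_p.mono (subset_univ _), ?_⟩
  have hcont : Continuous (uncurry sbar.v) :=
    (contDiffOn_univ.1 hsol.smooth_v).continuous
  refine hasBoundedEnergy_of_compact hcont hK fun q hq => ?_
  have h := hout q hq
  have hv : sbar.v q.1 q.2 = 0 := by simpa [WSection.eval] using congrArg Prod.fst h
  simpa [Function.uncurry] using hv

/-- The (v, p)-part of a global solution of a medium with `ρ = 1`, `χ = −ν`, `∇f = 0` is a Clay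
Navier–Stokes solution with viscosity `ν` and zero force from its own `t = 0` slice (equations (1)–(3);
the one-sided time derivative within `[0,∞)` of a globally smooth function is its derivative).
[cite: Prastaro2015Maslov, footnote 26 p. 28] -/
theorem isNavierStokesSolution_of_global {m : Medium} {ν : ℝ} (hρ : m.ρ = 1) (hχ : m.χ = -ν)
    (hf : ∀ x, gradient m.f x = 0) {sbar : WSection} (hsol : IsGlobalSolution m sbar) :
    IsNavierStokesSolution ν 0 (sbar.v 0) sbar.v sbar.p := by
  refine ⟨fun t _ x => ?_, fun t _ => ?_, rfl⟩
  · -- time differentiability of the slice line from joint smoothness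
    have hsm : ContDiff ℝ ∞ (uncurry sbar.v) := contDiffOn_univ.1 hsol.smooth_v
    have hline : Differentiable ℝ (fun s => sbar.v s x) := by
      have hc : ContDiff ℝ ∞ (fun s : ℝ => ((s, x) : ℝ × E3)) := contDiff_id.prodMk contDiff_const
      have hd : Differentiable ℝ (uncurry sbar.v ∘ fun s : ℝ => ((s, x) : ℝ × E3)) :=
        (hsm.comp hc).differentiable (by simp)
      exact hd
    have hdw : derivWithin (fun s => sbar.v s x) (Ici 0) t = deriv (fun s => sbar.v s x) t :=
      ((hline t).hasDerivAt.hasDerivWithinAt).derivWithin (uniqueDiffOn_Ici 0 t ‹_›)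
    rw [hdw]
    have h := hsol.eqC (t, x) (mem_univ _)
    simp only [EqC, hρ, hχ, one_smul, hf, smul_zero, add_zero, convect] at h
    -- h : fderiv (v t) x (v t x) + deriv + (-ν) • Δ + ∇p = 0
    have h' : deriv (fun τ => sbar.v τ x) t + fderiv ℝ (sbar.v t) x (sbar.v t x) =
        ν • (Δ (sbar.v t)) x - gradient (sbar.p t) x := by
      rw [neg_smul] at h
      have e : deriv (fun τ => sbar.v τ x) t + fderiv ℝ (sbar.v t) x (sbar.v t x)
          - (ν • (Δ (sbar.v t)) x - gradient (sbar.p t) x)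
          = fderiv ℝ (sbar.v t) x (sbar.v t x) + deriv (fun τ => sbar.v τ x) t +
              -(ν • (Δ (sbar.v t)) x) + gradient (sbar.p t) x := by abel
      rw [← sub_eq_zero, e, h]
    rw [h']
    simp
  · intro x
    have h := hsol.eqA (t, x) (mem_univ _)
    simpa [EqA, NSWave0.IsDivFree, NSWave0.divergence, VectorCalculus.divergence] using h

/-- **The Clay link as a typed delta** (TYPING-HYGIENE 10(b)): `ClayDelta → ClaimedTheorem → (A)`.
The claimed theorem is not used (the surjectivity delta subsumes everything the family could
contribute) — which is the kernel form of «wrong problem (Δ4/Δ6)»; `clay_of_claimed` alone is not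
provable. [cite: Prastaro2015Maslov, footnote 26 p. 28; abstract p. 1] -/
theorem clay_of_claimed_of_delta (hΔ : ClayDelta) (_h : ClaimedTheorem) :
    ClayVariants.clayR3.Regularity := by
  intro ν hν u₀ hu₀ hdiv hdec
  obtain ⟨m, p₀, θ₀, sbar, hρ, hχ, hf, hsol, ⟨K, hK, hout⟩, h0⟩ := hΔ ν hν u₀ hu₀ hdiv hdec
  obtain ⟨hsv, hsp, hE⟩ := footnote26_clayConditions hsol hK hout
  have hns := isNavierStokesSolution_of_global hρ hχ hf hsol
  rw [h0] at hns
  exact ⟨sbar.v, sbar.p, hsv, hsp, hns, hE⟩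


/-! ## D-0026 in-file discharges — Steps 1 and 2 (typist-9 g4, APPEND-ONLY)

Literature-side ports of the kernel proofs of ns-claims-salvage-p1 g2,
`Summit.NavierStokesRegularity.NavierStokesRegularity.Theorems.Prastaro2015.step1_holds` /
`step2_holds` (`Summits/…/Theorems/SoloSalvagePrastaro2015.lean`), which Literature cannot import:
the two steps preceding the load-bearing gluing / regularisation step (Lemma A2 / (A.6), locator
`Step4_concrete`, kernel-false Summits-side `…Theorems.Prastaro2015.not_Step4_concrete`) are
elementary and TRUE. No statement / def / locator / class above is touched.

WHAT THIS IS NOT: not a claim about NS regularity or blow-up; not a claim about any author beyond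
the typed locator. -/

/-- The Laplacian of a constant function vanishes. [folklore] -/
private theorem laplacian_const_eq_zero {F : Type*} [NormedAddCommGroup F] [NormedSpace ℝ F]
    (c : F) (x : E3) : (Δ (fun _ : E3 => c)) x = 0 := by
  rw [InnerProductSpace.laplacian_eq_iteratedFDeriv_orthonormalBasis _ (stdOrthonormalBasis ℝ E3)]
  simp [iteratedFDeriv_const_of_ne (𝕜 := ℝ) two_ne_zero c]

/-- **(A), (C), (D) at a constant section**: the constant section `(v₀, p₀, θ₀)` is a global smooth
solution as soon as `∇f ≡ 0`. Port of `…Theorems.Prastaro2015.isGlobalSolution_const`.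
[cite: Prastaro2015Maslov, Example 4.5 (66) p. 28] -/
theorem isGlobalSolution_const {m : Medium} (v₀ : E3) (p₀ θ₀ : ℝ) (hf : ∀ x, gradient m.f x = 0) :
    IsGlobalSolution m (WSection.const v₀ p₀ θ₀) where
  isOpen := isOpen_univ
  smooth_v := contDiffOn_const
  smooth_p := contDiffOn_const
  smooth_θ := contDiffOn_const
  eqA q _ := by
    simp only [EqA, WSection.const]
    simp [VectorCalculus.divergence]
  eqC q _ := by
    simp only [EqC, WSection.const]
    rw [laplacian_const_eq_zero, hf]
    simp [convect]
  eqD q _ := by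
    simp only [EqD, WSection.const]
    rw [laplacian_const_eq_zero]
    simp [frobeniusNormSq_zero]

/-- Conversely, a constant global solution forces `∇f ≡ 0` (equation (C) at `(0, x)`: `ρ ∇f(x) = 0`,
`ρ > 0`). Port of `…Theorems.Prastaro2015.gradient_f_eq_zero_of_const_solution`.
[cite: Prastaro2015Maslov, Example 4.5 (66) p. 28] -/
theorem gradient_f_eq_zero_of_const_solution {m : Medium} {v₀ : E3} {p₀ θ₀ : ℝ}
    (h : IsGlobalSolution m (WSection.const v₀ p₀ θ₀)) (x : E3) : gradient m.f x = 0 := by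
  have hC := h.eqC (0, x) (mem_univ _)
  simp only [EqC, WSection.const] at hC
  rw [laplacian_const_eq_zero] at hC
  have h' : m.ρ = 0 ∨ gradient m.f x = 0 := by simpa [convect] using hC
  exact h'.resolve_left m.ρ_pos.ne'

/-- **Step 1 holds** — Example 4.5 (66) p. 28: «such constant solutions exist iff they are localized in
a equipotential space-region», globally: iff `∇f ≡ 0`. Port of the Summits-side
`…Theorems.Prastaro2015.step1_holds` (salvage-p1 g2). [cite: Prastaro2015Maslov, Example 4.5 (66) p. 28] -/
theorem step1_holds : Step1_ConstantSolutions := fun _ v₀ p₀ θ₀ =>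
  ⟨fun h x => gradient_f_eq_zero_of_const_solution h x, fun hf => isGlobalSolution_const v₀ p₀ θ₀ hf⟩

/-- **Step 2 holds** — Lemma A1 p. 32, constructive core: near every space-time point a constant
global solution `s` admits a local smooth solution `s₀ ≠ s` — the constant section with pressure
shifted by `1` (a global solution by Step 1, restricted to the ball). Port of the Summits-side
`…Theorems.Prastaro2015.step2_holds` (salvage-p1 g2). [cite: Prastaro2015Maslov, Lemma A1 p. 32] -/
theorem step2_holds : Step2_LemmaA1 := by
  intro m s hs hsol q₀ δ hδ
  obtain ⟨v₀, p₀, θ₀, rfl⟩ := hs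
  have hf : ∀ x, gradient m.f x = 0 := gradient_f_eq_zero_of_const_solution hsol
  refine ⟨Metric.ball q₀ δ, WSection.const v₀ (p₀ + 1) θ₀, Metric.isOpen_ball, Metric.mem_ball_self hδ,
    Subset.rfl, IsSolutionOn.of_global (isGlobalSolution_const v₀ (p₀ + 1) θ₀ hf) Metric.isOpen_ball, q₀,
    Metric.mem_ball_self hδ, ?_⟩
  simp [WSection.eval_const]

end

end Literature.Claims.NS.Prastaro2015

/-! ## `_holds` aliases (appended 2026-08-28, flt-inv gen 65)

The named fact(s) below are already theorems of THIS file under another name; the alias records the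
discharge under the tree's exact naming convention `X_holds` (D-0026 bookkeeping: the proof term is the
existing theorem; no statement, definition or attribute is edited; no new named fact).  The ledger's debt
table listed each as unproved (`ledger fact claim` GRANTED «status unproved», 2026-08-28T08:5xZ). -/

/-- `Step1_ConstantSolutions` — Step 1 (Example 4.5 (66): the constant flows solve the system) holds (`Literature.Claims.NS.Prastaro2015.step1_holds`). [cite: Prastaro2015Maslov, Example 4.5 (66) p. 28] -/
theorem _root_.Literature.Claims.NS.Prastaro2015.Step1_ConstantSolutions_holds : _root_.Literature.Claims.NS.Prastaro2015.Step1_ConstantSolutions :=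
  _root_.Literature.Claims.NS.Prastaro2015.step1_holds

/-- `Step2_LemmaA1` — Step 2 (Lemma A1) holds (`Literature.Claims.NS.Prastaro2015.step2_holds`). [cite: Prastaro2015Maslov, Lemma A1 p. 32] -/
theorem _root_.Literature.Claims.NS.Prastaro2015.Step2_LemmaA1_holds : _root_.Literature.Claims.NS.Prastaro2015.Step2_LemmaA1 :=
  _root_.Literature.Claims.NS.Prastaro2015.step2_holds
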